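import Summits.KontsevichZagierPeriods.KontsevichZagierPeriods.Theorems.RealOnePeriodRelations.Negative.IntervalEuler

/-!
# `RealOnePeriodRelations` (stmt-KontsevichZagierPeriods-10042) — negative side: additivity and
# invariance of the Euler characteristic of a tame subset of `ℝ`

Second half of `Negative/IntervalEuler` (split for size): for `s ⊆ ℝ` with finitely many
connected components,

* `eulerChar_eq_sum_endWeight` — ADDITIVITY: for any finite disjoint decomposition of `s` into
  non-empty order-connected pieces, `eulerChar s` is the sum of the end weights of the pieces
  (independence of the decomposition; from `endWeight_eq_sum` on each component);
* `eulerChar_image` — INVARIANCE under maps `f` continuous and injective on `s` with tame image: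
  `f` is strictly monotone on each component (`strictMonoOn_or_strictAntiOn_of_ordConnected`), the
  image of a component is an interval of the same end weight, and additivity reassembles `f '' s`.

Used by `Negative/EulerCharacteristic` (rule 1a is load-bearing in the crux).
[van den Dries, *Tame topology and o-minimal structures* (1998), Ch. 4 §2; folklore in dimension 1]
-/

noncomputable section

open Set

namespace Summit.KontsevichZagierPeriods.SymplecticScissors.RealOnePeriodRelationsNegative


/-! ## §5 Additivity and invariance of the Euler characteristic -/

/-- The Euler characteristic is the sum of the end weights of the components. [folklore] -/
theorem eulerChar_eq_sum_comps {s : Set ℝ} (hs : (comps s).Finite) :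
    eulerChar s = ∑ K ∈ hs.toFinset, endWeight K := by
  rw [eulerChar, dif_pos hs]

/-- ADDITIVITY: for a set of reals with finitely many components, written as a finite disjoint
union of non-empty order-connected pieces, the Euler characteristic is the sum of the weights of
the pieces — independently of the decomposition. [folklore] -/
theorem eulerChar_eq_sum_endWeight {s : Set ℝ} (hs : (comps s).Finite) (P : Finset (Set ℝ))
    (hoc : ∀ I ∈ P, OrdConnected I) (hne : ∀ I ∈ P, I.Nonempty)
    (hdisj : ∀ I ∈ P, ∀ J ∈ P, I ≠ J → Disjoint I J) (hU : ⋃₀ (P : Set (Set ℝ)) = s) :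
    eulerChar s = ∑ I ∈ P, endWeight I := by
  classical
  rw [eulerChar_eq_sum_comps hs]
  have hIs : ∀ I ∈ P, I ⊆ s := fun I hI => hU ▸ subset_sUnion_of_mem hI
  -- the component of a piece
  let g : Set ℝ → Set ℝ := fun I => connectedComponentIn s (if h : I.Nonempty then h.some else 0)
  have hg : ∀ I ∈ P, g I ∈ hs.toFinset := fun I hI => by
    rw [Set.Finite.mem_toFinset]
    refine ⟨_, hIs I hI ?_, rfl⟩
    simp only [dif_pos (hne I hI)]
    exact (hne I hI).some_mem
  have hgI : ∀ I ∈ P, ∀ K ∈ hs.toFinset, (g I = K ↔ I ⊆ K) := fun I hI K hK => by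
    rw [Set.Finite.mem_toFinset] at hK
    have hx : (hne I hI).some ∈ I := (hne I hI).some_mem
    have hpre : IsPreconnected I := isPreconnected_iff_ordConnected.2 (hoc I hI)
    rw [subset_comps_iff hpre (hIs I hI) hx hK]
    simp only [g, dif_pos (hne I hI)]
    exact eq_comm
  rw [← Finset.sum_fiberwise_of_maps_to hg]
  refine Finset.sum_congr rfl fun K hK => ?_
  have hK' : K ∈ comps s := by rwa [Set.Finite.mem_toFinset] at hK
  have hfilter : P.filter (fun I => g I = K) = P.filter (fun I => I ⊆ K) :=
    Finset.filter_congr fun I hI => hgI I hI K hK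
  rw [hfilter]
  refine endWeight_eq_sum _ _ K rfl (comps_ordConnected hK') (comps_nonempty hK')
    (fun I hI => hoc I (Finset.mem_filter.1 hI).1) (fun I hI => hne I (Finset.mem_filter.1 hI).1)
    (fun I hI J hJ hIJ => hdisj I (Finset.mem_filter.1 hI).1 J (Finset.mem_filter.1 hJ).1 hIJ) ?_
  apply Subset.antisymm
  · rintro z ⟨I, hI, hz⟩
    rw [Finset.mem_coe, Finset.mem_filter] at hI
    exact hI.2 hz
  · intro z hz
    have hzs : z ∈ s := comps_subset hK' hz
    rw [← hU] at hzs
    obtain ⟨I, hI, hzI⟩ := hzs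
    refine ⟨I, ?_, hzI⟩
    rw [Finset.mem_coe, Finset.mem_filter]
    refine ⟨hI, ?_⟩
    rw [subset_comps_iff (isPreconnected_iff_ordConnected.2 (hoc I hI)) (hIs I hI) hzI hK']
    exact comps_eq_of_mem hK' hz

/-- A continuous injective map on a non-empty order-connected set of reals is strictly monotone
or strictly antitone there. [folklore] -/
theorem strictMonoOn_or_strictAntiOn_of_ordConnected {K : Set ℝ} (hK : OrdConnected K)
    (hne : K.Nonempty) {f : ℝ → ℝ} (hc : ContinuousOn f K) (hi : InjOn f K) :
    StrictMonoOn f K ∨ StrictAntiOn f K := by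
  haveI : Inhabited K := ⟨⟨hne.some, hne.some_mem⟩⟩
  haveI : OrdConnected K := hK
  have h : StrictMono (K.restrict f) ∨ StrictAnti (K.restrict f) :=
    Continuous.strictMono_of_inj hc.restrict hi.injective
  exact h.imp strictMono_restrict.mp strictAntiOn_iff_strictAnti.mpr

/-- A strictly monotone map preserves the end weight of its domain. [folklore] -/
theorem endWeight_image_of_strictMonoOn {K : Set ℝ} {f : ℝ → ℝ} (hf : StrictMonoOn f K) :
    endWeight (f '' K) = endWeight K := by
  have h1 : (∃ a, IsLeast (f '' K) a) ↔ ∃ a, IsLeast K a := by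
    constructor
    · rintro ⟨_, ⟨a, ha, rfl⟩, hle⟩
      refine ⟨a, ha, fun x hx => le_of_not_gt fun hxa => ?_⟩
      exact absurd (hle ⟨x, hx, rfl⟩) (not_le.2 (hf hx ha hxa))
    · rintro ⟨a, ha⟩
      exact ⟨f a, hf.monotoneOn.map_isLeast ha⟩
  have h2 : (∃ b, IsGreatest (f '' K) b) ↔ ∃ b, IsGreatest K b := by
    constructor
    · rintro ⟨_, ⟨b, hb, rfl⟩, hge⟩
      refine ⟨b, hb, fun x hx => le_of_not_gt fun hbx => ?_⟩
      exact absurd (hge ⟨x, hx, rfl⟩) (not_le.2 (hf hb hx hbx))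
    · rintro ⟨b, hb⟩
      exact ⟨f b, hf.monotoneOn.map_isGreatest hb⟩
  unfold endWeight
  rw [leftWeight_congr h1, rightWeight_congr h2]

/-- A strictly antitone map preserves the end weight of its domain (least and greatest elements
are exchanged). [folklore] -/
theorem endWeight_image_of_strictAntiOn {K : Set ℝ} {f : ℝ → ℝ} (hf : StrictAntiOn f K) :
    endWeight (f '' K) = endWeight K := by
  have h1 : (∃ a, IsLeast (f '' K) a) ↔ ∃ b, IsGreatest K b := by
    constructor
    · rintro ⟨_, ⟨a, ha, rfl⟩, hle⟩
      refine ⟨a, ha, fun x hx => le_of_not_gt fun hax => ?_⟩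
      exact absurd (hle ⟨x, hx, rfl⟩) (not_le.2 (hf ha hx hax))
    · rintro ⟨b, hb⟩
      exact ⟨f b, hf.antitoneOn.map_isGreatest hb⟩
  have h2 : (∃ b, IsGreatest (f '' K) b) ↔ ∃ a, IsLeast K a := by
    constructor
    · rintro ⟨_, ⟨b, hb, rfl⟩, hge⟩
      refine ⟨b, hb, fun x hx => le_of_not_gt fun hxb => ?_⟩
      exact absurd (hge ⟨x, hx, rfl⟩) (not_le.2 (hf hx hb hxb))
    · rintro ⟨a, ha⟩
      exact ⟨f a, hf.antitoneOn.map_isLeast ha⟩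
  have e1 : leftWeight (f '' K) = rightWeight K := leftWeight_eq_rightWeight h1
  have e2 : rightWeight (f '' K) = leftWeight K := (leftWeight_eq_rightWeight h2.symm).symm
  unfold endWeight
  rw [e1, e2]
  ring

/-- INVARIANCE: a continuous injection between sets of reals with finitely many components
preserves the Euler characteristic. [folklore] -/
theorem eulerChar_image {s : Set ℝ} (hs : (comps s).Finite) {f : ℝ → ℝ} (hc : ContinuousOn f s)
    (hi : InjOn f s) (ht : (comps (f '' s)).Finite) : eulerChar (f '' s) = eulerChar s := by
  classical
  have hpiece : ∀ K ∈ hs.toFinset, K ∈ comps s := fun K hK => by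
    rwa [Set.Finite.mem_toFinset] at hK
  have hdj : ∀ K ∈ hs.toFinset, ∀ K' ∈ hs.toFinset, K ≠ K' → Disjoint (f '' K) (f '' K') := by
    intro K hK K' hK' hKK'
    rw [Set.disjoint_left]
    rintro _ ⟨x, hx, rfl⟩ ⟨y, hy, hyx⟩
    have hxy : y = x :=
      hi (comps_subset (hpiece K' hK') hy) (comps_subset (hpiece K hK) hx) hyx
    exact Set.disjoint_left.1 (comps_disjoint (hpiece K hK) (hpiece K' hK') hKK') hx (hxy ▸ hy)
  have hinjK : ∀ K ∈ hs.toFinset, ∀ K' ∈ hs.toFinset, f '' K = f '' K' → K = K' := by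
    intro K hK K' hK' hKK'
    by_contra hne
    obtain ⟨x, hx⟩ := comps_nonempty (hpiece K hK)
    have h := hdj K hK K' hK' hne
    have m1 : f x ∈ f '' K := ⟨x, hx, rfl⟩
    have m2 : f x ∈ f '' K' := hKK' ▸ m1
    exact Set.disjoint_left.1 h m1 m2
  have hoc : ∀ I ∈ hs.toFinset.image (fun K => f '' K), OrdConnected I := by
    intro I hI
    obtain ⟨K, hK, rfl⟩ := Finset.mem_image.1 hI
    have hK' := hpiece K hK
    exact isPreconnected_iff_ordConnected.1
      ((isPreconnected_iff_ordConnected.2 (comps_ordConnected hK')).image f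
        (hc.mono (comps_subset hK')))
  have hne : ∀ I ∈ hs.toFinset.image (fun K => f '' K), I.Nonempty := by
    intro I hI
    obtain ⟨K, hK, rfl⟩ := Finset.mem_image.1 hI
    exact (comps_nonempty (hpiece K hK)).image f
  have hdj' : ∀ I ∈ hs.toFinset.image (fun K => f '' K), ∀ J ∈ hs.toFinset.image (fun K => f '' K),
      I ≠ J → Disjoint I J := by
    intro I hI J hJ hIJ
    obtain ⟨K, hK, rfl⟩ := Finset.mem_image.1 hI
    obtain ⟨K', hK', rfl⟩ := Finset.mem_image.1 hJ
    exact hdj K hK K' hK' fun h => hIJ (h ▸ rfl)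
  have hun : ⋃₀ ((hs.toFinset.image fun K => f '' K : Finset (Set ℝ)) : Set (Set ℝ)) = f '' s := by
    apply Subset.antisymm
    · rintro _ ⟨I, hI, hz⟩
      obtain ⟨K, hK, rfl⟩ := Finset.mem_image.1 hI
      obtain ⟨x, hx, rfl⟩ := hz
      exact ⟨x, comps_subset (hpiece K hK) hx, rfl⟩
    · rintro _ ⟨x, hx, rfl⟩
      refine ⟨f '' connectedComponentIn s x, ?_, ⟨x, mem_connectedComponentIn hx, rfl⟩⟩
      rw [Finset.mem_coe, Finset.mem_image]
      exact ⟨_, by rw [Set.Finite.mem_toFinset]; exact mem_comps_of_mem hx, rfl⟩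
  rw [eulerChar_eq_sum_endWeight ht _ hoc hne hdj' hun, Finset.sum_image hinjK,
    eulerChar_eq_sum_comps hs]
  refine Finset.sum_congr rfl fun K hK => ?_
  have hK' := hpiece K hK
  rcases strictMonoOn_or_strictAntiOn_of_ordConnected (comps_ordConnected hK') (comps_nonempty hK')
    (hc.mono (comps_subset hK')) (hi.mono (comps_subset hK')) with h | h
  · exact endWeight_image_of_strictMonoOn h
  · exact endWeight_image_of_strictAntiOn h

end Summit.KontsevichZagierPeriods.SymplecticScissors.RealOnePeriodRelationsNegative

end
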